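import Summits.Ventures.Crystal3D.Theorems.StickyWulffConstantNoReconstructionGainExactPeel
import Mathlib.Combinatorics.Hall.Basic
import Mathlib.SetTheory.Cardinal.Order
import HarnessLib

/-!
# Exact zero gain ⟺ an orientation certificate for every film (Hakimi; line `replication-exactness`, stub CERTIFICATE)

HONEST FRAMING. Part of the venture `Summits/Ventures/Crystal3D` (cell `crystal3d-full`), supports the
crux `NoReconstructionGain` (stmt-Ventures-19144, route `route-Ventures-StickyWulffConstant`), line
`replication-exactness` (skeleton v2, lead wulff-p1 g17; objects in `…NoReconstructionGainExactDefs`).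
This file lands the registered stub

* `stub_certificate_iff : ExactZeroGain ↔ OrientationCertificate` — exact zero gain on every rigid
  half-crystal face holds iff the contact graph of every film has an orientation with
  `indeg(q) + plug(q) ≤ 6` at every ball (COMPLETENESS of integral, rim-free flow certificates: certificate
  search is without loss).

Proof.  `←`: sum the per-ball bounds; the orientation contributes exactly one unit per contact pair
(`sum_sum_filter_eq`, `sum_pairs_swap`), so `X(H,Q) + C(Q) ≤ 6·#Q`.  `→` (Hakimi 1965 via HALL's theorem,
`Finset.all_card_le_biUnion_card_iff_exists_injective`): represent each contact pair once (well-order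
representatives), give each ball `q` the `6 − plug(q)` slots `{q} × range (6 − plug q)`
(`plug ≤ 6` by EXACT₀ on the one-ball film, `plugSet_ncard_le_six`); Hall's condition for a set of pairs with
endpoint set `U ⊆ Q` is `#pairs(U) ≤ Σ_{q∈U} (6 − plug q)`, which is EXACT₀ for the sub-film `U`
(`two_mul_card_contactReps`: ordered contacts `= 2·#pairs`); an injective assignment of pairs to slots
orients each pair INTO the owner of its slot, with in-degree at most the number of slots.

WHAT THIS IS NOT: neither side is proved here — EXACT₀ is the crux proper in exact form (`stub_noCriminal`,
open); rung F-C1 not moved.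
-/

noncomputable section

namespace Summit.Ventures.Crystal3D.Theorems

open Literature.MathematicalPhysics.StatisticalMechanics (fccStacking contactDeficiency orderedContacts)
open scoped InnerProductSpace
open Finset

/-! ## Tools -/

/-- EXACT₀ bounds the plugs of a single film ball by `6`. -/
theorem plugSet_ncard_le_six (hE : ExactZeroGain) {ν : EuclideanSpace ℝ (Fin 3)} (hν : ‖ν‖ = 1)
    {s : ℝ} {Q : Finset (EuclideanSpace ℝ (Fin 3))} (hQ : IsFilmOn ν s Q)
    {q : EuclideanSpace ℝ (Fin 3)} (hq : q ∈ Q) : (plugSet ν s q).ncard ≤ 6 := by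
  have h1 : IsFilmOn ν s {q} := hQ.subset (Finset.singleton_subset_iff.2 hq)
  have h2 := hE ν hν s {q} h1
  rw [plugCount, Finset.sum_singleton, contactDeficiency_singleton] at h2
  exact_mod_cast h2

/-- The double sum over (ball, partner) is the sum over ordered contact pairs. -/
theorem sum_sum_filter_eq (Q : Finset (EuclideanSpace ℝ (Fin 3)))
    (g : EuclideanSpace ℝ (Fin 3) → EuclideanSpace ℝ (Fin 3) → ℕ) :
    ∑ q ∈ Q, ∑ q' ∈ Q.filter (fun q' => dist q q' = 1), g q' q =
      ∑ pq ∈ (Q ×ˢ Q).filter (fun pq => dist pq.1 pq.2 = 1), g pq.2 pq.1 := by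
  classical
  rw [Finset.sum_filter, Finset.sum_product]
  refine Finset.sum_congr rfl fun q _ => ?_
  rw [Finset.sum_filter]

/-- The ordered contact pairs are symmetric under swapping. -/
theorem sum_pairs_swap (Q : Finset (EuclideanSpace ℝ (Fin 3)))
    (g : EuclideanSpace ℝ (Fin 3) → EuclideanSpace ℝ (Fin 3) → ℕ) :
    ∑ pq ∈ (Q ×ˢ Q).filter (fun pq => dist pq.1 pq.2 = 1), g pq.2 pq.1 =
      ∑ pq ∈ (Q ×ˢ Q).filter (fun pq => dist pq.1 pq.2 = 1), g pq.1 pq.2 := by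
  classical
  refine Finset.sum_nbij' Prod.swap Prod.swap ?_ ?_ (fun _ _ => rfl) (fun _ _ => rfl) (fun _ _ => rfl)
  · intro pq hpq
    simp only [Finset.mem_filter, Finset.mem_product] at hpq ⊢
    exact ⟨⟨hpq.1.2, hpq.1.1⟩, by rw [Prod.fst_swap, Prod.snd_swap, dist_comm]; exact hpq.2⟩
  · intro pq hpq
    simp only [Finset.mem_filter, Finset.mem_product] at hpq ⊢
    exact ⟨⟨hpq.1.2, hpq.1.1⟩, by rw [Prod.fst_swap, Prod.snd_swap, dist_comm]; exact hpq.2⟩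

/-- **Summation: the per-ball form.**  For any `o` with `o q q' + o q' q = 1` on contact pairs,
`Σ_q indeg(q) = C(Q)`, i.e. twice the orientation sum is the number of ordered contacts. -/
theorem two_mul_sum_orientation (Q : Finset (EuclideanSpace ℝ (Fin 3)))
    (o : EuclideanSpace ℝ (Fin 3) → EuclideanSpace ℝ (Fin 3) → ℕ)
    (ho : ∀ q ∈ Q, ∀ q' ∈ Q, dist q q' = 1 → o q q' + o q' q = 1) :
    2 * ∑ q ∈ Q, ∑ q' ∈ Q.filter (fun q' => dist q q' = 1), o q' q = orderedContacts Q := by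
  classical
  rw [sum_sum_filter_eq, two_mul]
  nth_rewrite 2 [sum_pairs_swap Q o]
  rw [← Finset.sum_add_distrib]
  unfold orderedContacts
  rw [Finset.card_eq_sum_ones]
  refine Finset.sum_congr rfl fun pq hpq => ?_
  simp only [Finset.mem_filter, Finset.mem_product] at hpq
  have h := ho pq.1 hpq.1.1 pq.2 hpq.1.2 hpq.2
  omega

/-! ## `←`: summing an orientation certificate -/

/-- An orientation certificate for every film gives exact zero gain. -/
theorem exactZeroGain_of_orientationCertificate : OrientationCertificate → ExactZeroGain := by
  classical
  intro hO ν hν s Q hQ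
  obtain ⟨o, ho, hdeg⟩ := hO ν hν s Q hQ
  have hsum : ∑ q ∈ Q, ((plugSet ν s q).ncard +
      ∑ q' ∈ Q.filter (fun q' => dist q q' = 1), o q' q) ≤ 6 * Q.card := by
    calc _ ≤ ∑ q ∈ Q, 6 := Finset.sum_le_sum fun q hq => hdeg q hq
      _ = 6 * Q.card := by rw [Finset.sum_const, smul_eq_mul, mul_comm]
  rw [Finset.sum_add_distrib] at hsum
  have h2 := two_mul_sum_orientation Q o ho
  have hpc : plugCount ν s Q = ∑ q ∈ Q, (plugSet ν s q).ncard := rfl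
  unfold contactDeficiency
  have h3 : (2 : ℝ) * (∑ q ∈ Q, ∑ q' ∈ Q.filter (fun q' => dist q q' = 1), o q' q : ℕ) =
      (orderedContacts Q : ℝ) := by exact_mod_cast h2
  have h4 : ((plugCount ν s Q : ℕ) : ℝ) + (∑ q ∈ Q, ∑ q' ∈ Q.filter (fun q' => dist q q' = 1), o q' q : ℕ)
      ≤ 6 * (Q.card : ℝ) := by rw [hpc]; exact_mod_cast hsum
  linarith

/-! ## `→`: Hakimi's orientation theorem via Hall -/

/-- Trichotomy of the well-order for distinct points. -/
theorem wellOrderingRel_or {a b : EuclideanSpace ℝ (Fin 3)} (h : a ≠ b) :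
    WellOrderingRel a b ∨ WellOrderingRel b a := by
  rcases trichotomous_of WellOrderingRel a b with h1 | h1 | h1
  · exact Or.inl h1
  · exact absurd h1 h
  · exact Or.inr h1

/-- Asymmetry of the well-order. -/
theorem wellOrderingRel_asymm {a b : EuclideanSpace ℝ (Fin 3)} (h : WellOrderingRel a b) :
    ¬ WellOrderingRel b a := by
  intro h'
  exact irrefl_of WellOrderingRel a (_root_.trans h h')

open scoped Classical in
/-- Ordered contacts are twice the contact pairs (one representative of each pair by a fixed well-order
of space). -/
theorem two_mul_card_contactReps (U : Finset (EuclideanSpace ℝ (Fin 3))) :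
    2 * ((U ×ˢ U).filter fun pq => dist pq.1 pq.2 = 1 ∧ WellOrderingRel pq.1 pq.2).card = orderedContacts U := by
  classical
  have hsplit := Finset.card_filter_add_card_filter_not
    (s := (U ×ˢ U).filter fun pq => dist pq.1 pq.2 = 1) (fun pq => WellOrderingRel pq.1 pq.2)
  have h1 : ((U ×ˢ U).filter fun pq => dist pq.1 pq.2 = 1).filter
      (fun pq => WellOrderingRel pq.1 pq.2) = ((U ×ˢ U).filter fun pq => dist pq.1 pq.2 = 1 ∧ WellOrderingRel pq.1 pq.2) := by
    rw [Finset.filter_filter]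
  -- the swap is a bijection between the two halves
  have h2 : (((U ×ˢ U).filter fun pq => dist pq.1 pq.2 = 1).filter
      fun pq => ¬ WellOrderingRel pq.1 pq.2).card =
      (((U ×ˢ U).filter fun pq => dist pq.1 pq.2 = 1).filter
      fun pq => WellOrderingRel pq.1 pq.2).card := by
    refine Finset.card_nbij' Prod.swap Prod.swap ?_ ?_ (fun _ _ => rfl) (fun _ _ => rfl)
    · intro pq hpq
      rw [Finset.mem_coe, Finset.mem_filter, Finset.mem_filter, Finset.mem_product] at hpq ⊢
      have hne : pq.1 ≠ pq.2 := by
        intro h; have := hpq.1.2; rw [h, dist_self] at this; norm_num at this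
      refine ⟨⟨⟨hpq.1.1.2, hpq.1.1.1⟩, ?_⟩, ?_⟩
      · rw [Prod.fst_swap, Prod.snd_swap, dist_comm]; exact hpq.1.2
      · rw [Prod.fst_swap, Prod.snd_swap]
        exact (wellOrderingRel_or hne).resolve_left hpq.2
    · intro pq hpq
      rw [Finset.mem_coe, Finset.mem_filter, Finset.mem_filter, Finset.mem_product] at hpq ⊢
      refine ⟨⟨⟨hpq.1.1.2, hpq.1.1.1⟩, ?_⟩, ?_⟩
      · rw [Prod.fst_swap, Prod.snd_swap, dist_comm]; exact hpq.1.2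
      · rw [Prod.fst_swap, Prod.snd_swap]
        exact wellOrderingRel_asymm hpq.2
  unfold orderedContacts
  rw [← h1]
  omega

open scoped Classical in
/-- **Hall's condition from EXACT₀**: the contact pairs inside a block `U` of a film are at most the
slots `Σ_{q∈U} (6 − plug q)`. -/
theorem card_contactReps_le_slots (hE : ExactZeroGain) {ν : EuclideanSpace ℝ (Fin 3)} (hν : ‖ν‖ = 1)
    {s : ℝ} {Q U : Finset (EuclideanSpace ℝ (Fin 3))} (hQ : IsFilmOn ν s Q) (hU : U ⊆ Q) :
    ((U ×ˢ U).filter fun pq => dist pq.1 pq.2 = 1 ∧ WellOrderingRel pq.1 pq.2).card ≤ ∑ q ∈ U, (6 - (plugSet ν s q).ncard) := by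
  classical
  have hEU := hE ν hν s U (hQ.subset hU)
  have h2 := two_mul_card_contactReps U
  have h6 : ∀ q ∈ U, (plugSet ν s q).ncard ≤ 6 := fun q hq => plugSet_ncard_le_six hE hν hQ (hU hq)
  have hslots : ∑ q ∈ U, (6 - (plugSet ν s q).ncard) + plugCount ν s U = 6 * U.card := by
    unfold plugCount
    rw [← Finset.sum_add_distrib, Finset.card_eq_sum_ones, Finset.mul_sum]
    refine Finset.sum_congr rfl fun q hq => ?_
    have := h6 q hq
    omega
  unfold contactDeficiency at hEU
  have h3 : (2 : ℝ) * (((U ×ˢ U).filter fun pq => dist pq.1 pq.2 = 1 ∧ WellOrderingRel pq.1 pq.2).card : ℕ) = (orderedContacts U : ℝ) := by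
    exact_mod_cast h2
  have h4 : ((∑ q ∈ U, (6 - (plugSet ν s q).ncard) : ℕ) : ℝ) + (plugCount ν s U : ℕ) =
      6 * (U.card : ℝ) := by exact_mod_cast hslots
  have h5 : (((U ×ˢ U).filter fun pq => dist pq.1 pq.2 = 1 ∧ WellOrderingRel pq.1 pq.2).card : ℝ) ≤
      ((∑ q ∈ U, (6 - (plugSet ν s q).ncard) : ℕ) : ℝ) := by
    linarith
  exact_mod_cast h5

/-- EXACT₀ gives an orientation certificate for every film (Hakimi via Hall). -/
theorem orientationCertificate_of_exactZeroGain : ExactZeroGain → OrientationCertificate := by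
  classical
  intro hE ν hν s Q hQ
  -- slots and the Hall family on the contact pairs of `Q`
  set c : EuclideanSpace ℝ (Fin 3) → ℕ := fun q => 6 - (plugSet ν s q).ncard with hc
  set slots : EuclideanSpace ℝ (Fin 3) → Finset (EuclideanSpace ℝ (Fin 3) × ℕ) :=
    fun q => ({q} : Finset (EuclideanSpace ℝ (Fin 3))) ×ˢ Finset.range (c q) with hslots
  set Ed := ((Q ×ˢ Q).filter fun pq => dist pq.1 pq.2 = 1 ∧ WellOrderingRel pq.1 pq.2) with hEd
  set t : Ed → Finset (EuclideanSpace ℝ (Fin 3) × ℕ) := fun e => slots e.1.1 ∪ slots e.1.2 with ht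
  have hmemEd : ∀ e : Ed, e.1.1 ∈ Q ∧ e.1.2 ∈ Q ∧ dist e.1.1 e.1.2 = 1 ∧ WellOrderingRel e.1.1 e.1.2 := by
    intro e
    have h : (e : EuclideanSpace ℝ (Fin 3) × EuclideanSpace ℝ (Fin 3)) ∈
        (Q ×ˢ Q).filter fun pq => dist pq.1 pq.2 = 1 ∧ WellOrderingRel pq.1 pq.2 := e.2
    rw [Finset.mem_filter, Finset.mem_product] at h
    exact ⟨h.1.1, h.1.2, h.2.1, h.2.2⟩
  have hslots_card : ∀ q, (slots q).card = c q := by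
    intro q; rw [hslots]; simp
  have hslots_mem : ∀ q x, x ∈ slots q → x.1 = q := by
    intro q x hx
    rw [hslots] at hx
    simp only [Finset.mem_product, Finset.mem_singleton, Finset.mem_range] at hx
    exact hx.1
  have hslots_disj : ∀ q q', q ≠ q' → Disjoint (slots q) (slots q') := by
    intro q q' hne
    rw [Finset.disjoint_left]
    intro x hx hx'
    exact hne ((hslots_mem q x hx).symm.trans (hslots_mem q' x hx'))
  -- Hall's condition
  have hHall : ∀ S : Finset Ed, S.card ≤ (S.biUnion t).card := by
    intro S
    set U : Finset (EuclideanSpace ℝ (Fin 3)) :=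
      S.image (fun e => e.1.1) ∪ S.image (fun e => e.1.2) with hU
    have hUQ : U ⊆ Q := by
      intro q hq
      rw [hU, Finset.mem_union, Finset.mem_image, Finset.mem_image] at hq
      rcases hq with ⟨e, -, rfl⟩ | ⟨e, -, rfl⟩
      · exact (hmemEd e).1
      · exact (hmemEd e).2.1
    -- the pairs of `S` are contact pairs inside `U`
    have hS : S.card ≤ ((U ×ˢ U).filter fun pq => dist pq.1 pq.2 = 1 ∧ WellOrderingRel pq.1 pq.2).card := by
      refine Finset.card_le_card_of_injOn (fun e => e.1) ?_ ?_
      · intro e he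
        obtain ⟨-, -, hd, hr⟩ := hmemEd e
        rw [Finset.mem_coe]
        show (e : EuclideanSpace ℝ (Fin 3) × EuclideanSpace ℝ (Fin 3)) ∈
          (U ×ˢ U).filter fun pq => dist pq.1 pq.2 = 1 ∧ WellOrderingRel pq.1 pq.2
        refine Finset.mem_filter.2 ⟨Finset.mem_product.2 ⟨?_, ?_⟩, hd, hr⟩
        · rw [hU, Finset.mem_union]; exact Or.inl (Finset.mem_image.2 ⟨e, he, rfl⟩)
        · rw [hU, Finset.mem_union]; exact Or.inr (Finset.mem_image.2 ⟨e, he, rfl⟩)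
      · intro e _ e' _ h
        exact Subtype.ext h
    -- the slots of `U` are available
    have hsub : U.biUnion slots ⊆ S.biUnion t := by
      intro x hx
      rw [Finset.mem_biUnion] at hx ⊢
      obtain ⟨q, hq, hxq⟩ := hx
      rw [hU, Finset.mem_union, Finset.mem_image, Finset.mem_image] at hq
      rcases hq with ⟨e, he, rfl⟩ | ⟨e, he, rfl⟩
      · exact ⟨e, he, Finset.mem_union.2 (Or.inl hxq)⟩
      · exact ⟨e, he, Finset.mem_union.2 (Or.inr hxq)⟩
    have hcardU : (U.biUnion slots).card = ∑ q ∈ U, c q := by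
      rw [Finset.card_biUnion (fun q _ q' _ hne => hslots_disj q q' hne)]
      exact Finset.sum_congr rfl fun q _ => hslots_card q
    calc S.card ≤ ((U ×ˢ U).filter fun pq => dist pq.1 pq.2 = 1 ∧ WellOrderingRel pq.1 pq.2).card := hS
      _ ≤ ∑ q ∈ U, c q := card_contactReps_le_slots hE hν hQ hUQ
      _ = (U.biUnion slots).card := hcardU.symm
      _ ≤ (S.biUnion t).card := Finset.card_le_card hsub
  obtain ⟨f, hfinj, hft⟩ := (Finset.all_card_le_biUnion_card_iff_exists_injective t).1 hHall
  -- total extension of the matching and the orientation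
  set F : EuclideanSpace ℝ (Fin 3) × EuclideanSpace ℝ (Fin 3) → EuclideanSpace ℝ (Fin 3) × ℕ :=
    fun e => if h : e ∈ Ed then f ⟨e, h⟩ else (0, 0) with hF
  set edge : EuclideanSpace ℝ (Fin 3) → EuclideanSpace ℝ (Fin 3) →
      EuclideanSpace ℝ (Fin 3) × EuclideanSpace ℝ (Fin 3) :=
    fun q q' => if WellOrderingRel q q' then (q, q') else (q', q) with hedge
  set o : EuclideanSpace ℝ (Fin 3) → EuclideanSpace ℝ (Fin 3) → ℕ :=
    fun q' q => if edge q q' ∈ Ed ∧ (F (edge q q')).1 = q then 1 else 0 with ho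
  have hF_mem : ∀ e (h : e ∈ Ed), F e ∈ slots e.1 ∪ slots e.2 := by
    intro e h
    have : F e = f ⟨e, h⟩ := by rw [hF]; exact dif_pos h
    rw [this]; exact hft ⟨e, h⟩
  have hF_inj : ∀ e e', e ∈ Ed → e' ∈ Ed → F e = F e' → e = e' := by
    intro e e' h h' hFe
    have h1 : F e = f ⟨e, h⟩ := by rw [hF]; exact dif_pos h
    have h2 : F e' = f ⟨e', h'⟩ := by rw [hF]; exact dif_pos h'
    rw [h1, h2] at hFe
    exact congrArg Subtype.val (hfinj hFe)
  -- the representative of a contact pair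
  have hedge_symm : ∀ q q', q ≠ q' → edge q' q = edge q q' := by
    intro q q' hne
    rcases wellOrderingRel_or hne with h | h
    · have h' := wellOrderingRel_asymm h
      simp only [hedge, if_pos h, if_neg h']
    · have h' := wellOrderingRel_asymm h
      simp only [hedge, if_pos h, if_neg h']
  have hedge_mem : ∀ q ∈ Q, ∀ q' ∈ Q, dist q q' = 1 → edge q q' ∈ Ed ∧
      (edge q q' = (q, q') ∨ edge q q' = (q', q)) := by
    intro q hq q' hq' hd
    have hne : q ≠ q' := by intro h; rw [h, dist_self] at hd; norm_num at hd
    rcases wellOrderingRel_or hne with h | h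
    · have he : edge q q' = (q, q') := by simp only [hedge, if_pos h]
      refine ⟨?_, Or.inl he⟩
      rw [he, hEd]
      exact Finset.mem_filter.2 ⟨Finset.mem_product.2 ⟨hq, hq'⟩, hd, h⟩
    · have h' := wellOrderingRel_asymm h
      have he : edge q q' = (q', q) := by simp only [hedge, if_neg h']
      refine ⟨?_, Or.inr he⟩
      rw [he, hEd]
      exact Finset.mem_filter.2 ⟨Finset.mem_product.2 ⟨hq', hq⟩, by rw [dist_comm]; exact hd, h⟩
  refine ⟨o, ?_, ?_⟩
  · -- each contact pair is oriented exactly one way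
    intro q hq q' hq' hd
    have hne : q ≠ q' := by intro h; rw [h, dist_self] at hd; norm_num at hd
    obtain ⟨hmem, hcases⟩ := hedge_mem q hq q' hq' hd
    have hx := hF_mem (edge q q') hmem
    rw [Finset.mem_union] at hx
    have hfirst : (F (edge q q')).1 = q ∨ (F (edge q q')).1 = q' := by
      rcases hcases with h | h <;> rw [h] at hx ⊢ <;> rcases hx with hx | hx
      · exact Or.inl (hslots_mem _ _ hx)
      · exact Or.inr (hslots_mem _ _ hx)
      · exact Or.inr (hslots_mem _ _ hx)
      · exact Or.inl (hslots_mem _ _ hx)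
    have heq := hedge_symm q q' hne
    simp only [ho, heq]
    rcases hfirst with h1 | h1
    · have h2 : (F (edge q q')).1 ≠ q' := by rw [h1]; exact hne
      rw [if_neg (fun h => h2 h.2), if_pos ⟨hmem, h1⟩]
    · have h2 : (F (edge q q')).1 ≠ q := by rw [h1]; exact hne.symm
      rw [if_pos ⟨hmem, h1⟩, if_neg (fun h => h2 h.2)]
  · -- in-degree plus plugs is at most six
    intro q hq
    have h6 := plugSet_ncard_le_six hE hν hQ hq
    set T := (Q.filter fun q' => dist q q' = 1).filter
      (fun q' => edge q q' ∈ Ed ∧ (F (edge q q')).1 = q) with hT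
    have hsumT : ∑ q' ∈ Q.filter (fun q' => dist q q' = 1), o q' q = T.card := by
      rw [hT, Finset.card_filter]
    have hTc : T.card ≤ (slots q).card := by
      refine Finset.card_le_card_of_injOn (fun q' => F (edge q q')) ?_ ?_
      · intro q' hq'
        rw [Finset.mem_coe, hT, Finset.mem_filter, Finset.mem_filter] at hq'
        obtain ⟨⟨hq'Q, hd⟩, hmem, hfirst⟩ := hq'
        have hx := hF_mem (edge q q') hmem
        rw [Finset.mem_coe]
        show F (edge q q') ∈ slots q
        rw [Finset.mem_union] at hx
        rcases hx with hx | hx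
        · have e1 : (edge q q').1 = q := (hslots_mem _ _ hx).symm.trans hfirst
          rw [e1] at hx; exact hx
        · have e2 : (edge q q').2 = q := (hslots_mem _ _ hx).symm.trans hfirst
          rw [e2] at hx; exact hx
      · intro q₁ hq₁ q₂ hq₂ hF12
        rw [Finset.mem_coe, hT, Finset.mem_filter, Finset.mem_filter] at hq₁ hq₂
        have hne₁ : q ≠ q₁ := by intro h; have := hq₁.1.2; rw [h, dist_self] at this; norm_num at this
        have hne₂ : q ≠ q₂ := by intro h; have := hq₂.1.2; rw [h, dist_self] at this; norm_num at this
        have he := hF_inj _ _ hq₁.2.1 hq₂.2.1 hF12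
        obtain ⟨-, hc₁⟩ := hedge_mem q hq q₁ hq₁.1.1 hq₁.1.2
        obtain ⟨-, hc₂⟩ := hedge_mem q hq q₂ hq₂.1.1 hq₂.1.2
        rcases hc₁ with h₁ | h₁ <;> rcases hc₂ with h₂ | h₂ <;> rw [h₁, h₂] at he <;>
          simp only [Prod.mk.injEq] at he
        · exact he.2
        · exact absurd he.1 hne₂
        · exact absurd he.1.symm hne₁
        · exact he.1
    rw [hsumT]
    have h1 := hslots_card q
    have hcq : c q = 6 - (plugSet ν s q).ncard := rfl
    omega

/-- **STUB `stub_certificate_iff` of the line `replication-exactness` (M): completeness of integral flow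
certificates (Hakimi).**  Exact zero gain holds for every film on every rigid half-crystal face iff every
film's contact graph has an orientation with `indeg + plug ≤ 6` at every ball. -/
theorem stub_certificate_iff : ExactZeroGain ↔ OrientationCertificate :=
  ⟨orientationCertificate_of_exactZeroGain, exactZeroGain_of_orientationCertificate⟩

end Summit.Ventures.Crystal3D.Theorems

end
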